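import Summits.HodgeConjecture.HodgeConjecture.Theorems.AnchorTransportVariationalHodgePadicEffectiveProClasses
import Summits.HodgeConjecture.HodgeConjecture.Theorems.AnchorTransportVariationalHodgePadicEffectiveProClassesSemiregular
import Summits.HodgeConjecture.HodgeConjecture.Theorems.AnchorTransportVariationalHodgePadicModelSupply
import Literature.AlgebraicGeometry.Motives.GrothendieckExistenceWittProjective

/-!
# Route AnchorTransport — crux `VariationalHodge` (stmt-HodgeConjecture-1076), line `padic-disc-transport`:
# STUB P on EFFECTIVE pro-classes is UNCONDITIONAL on the line's carriers (projective `W(κ)`-models)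

HONEST FRAMING: research route conditional on HC_CM; not a corollary; Q11.4-sentence-2 already refuted in dim ≥ 3.
Helper file on the crux item (nothing here closes it; no definition, no named fact, no `sorry`;
`HC_CM` does not occur). Cell `pub-hodge-ring2`, binder seat `ring2-b03` (gen 40), BINDER-OWNERS row b03.

Gen 39 (`…PadicEffectiveProClasses{,Semiregular}.lean`) put the KNOWN part of the line's bet, STUB P
(`PadicDiscTransport.PadicImageAlgebraization`; conclusion `PadicDiscTransport.ProClassAlgebraizes`,
spelled out VERBATIM below since the skeleton's local `def`s are not importable under `Theorems/`), in
the kernel MODULO Grothendieck's existence theorem for vector bundles over `W(κ)` — the Literature named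
fact `Motives.GrothendieckExistence_vectorBundle_witt` (all proper models), resp. route
`PadicSemiregularLift`'s item P3a `FormalVectorBundlesAlgebraize` (stmt-HodgeConjecture-14106).

The Literature theorem `Motives.liftsTo_of_liftsFormally_of_isProjectiveOverRing`
(`Motives/GrothendieckExistenceWittProjective`: Görtz–Wedhorn II Thm. 24.94 + Prop. 24.95 in the
PROJECTIVE case, Lemma 24.103 = EGA III₁ 5.1.4 + 5.2.4, proved from the tree's `FormalModule*` series)
discharges that hypothesis on models PROJECTIVE over `W(κ)` (`Crystalline.IsProjectiveOverRing`) — and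
every model the line ever produces is such: `padicModelSupply_projective` (gen 33) and
`padicDiscData_of_isQuasiProjectiveOver` (gen 36) supply `IsProjectiveOverRing 𝒴` (it is also the
hypothesis of Bloch–Esnault–Kerz's Thm. 1.3, `Crystalline.BlochEsnaultKerzLifting`). Hence, with NO
hypothesis left:

* `proClassAlgebraizes_of_tower_of_isProjectiveOverRing` — **STUB P holds for every rational pro-class
  whose bottom class is effective (the class of the bottom bundle of a compatible tower of vector
  bundles on the thickenings), on every `W(κ)`-scheme projective over `W(κ)`, `κ` perfect** (the
  line-bundle case of Bloch–Esnault–Kerz §1 (1.3) "Grothendieck's formal existence theorem gives an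
  algebraization isomorphism", for vector bundles of any rank); `ℚ`-span form
  `proClassAlgebraizes_of_mem_span_effective_of_isProjectiveOverRing`;
* `padicImageAlgebraization_effective_projective` — STUB P's quantifier block VERBATIM with TWO extra
  binders (`IsProjectiveOverRing 𝒴`; effectivity of `ξ̂|_{X_0}`), `p₀ = 0`, **no hypothesis**;
* `proClassAlgebraizes_of_tower_of_padicModelSupply` — on the line's own models (those of
  `padicModelSupply_projective`, for any complex smooth projective variety) every effective pro-class
  algebraizes;
* the junction with route `PadicSemiregularLift` WITHOUT P3a: `proClassAlgebraizes_of_formalLiftingFromClassLifting`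
  (**P1a alone ⟹ STUB P's conclusion for pro-classes with a (⋆)-bottom bundle on P1a-models** — P1a's
  models are projective over `W`), `proClassAlgebraizes_of_hu_of_hodgeDeRhamDegeneration_of_isProjectiveOverRing`
  (from P1a's antecedents `HuInfinitesimalKZero ∧ HodgeDeRhamDegeneration` through the closed glue), and
  `padicImageAlgebraization_star_of_formalLiftingFromClassLifting` (STUB P's block with the junction
  binders, `p₀ = d + 7`, from P1a alone).

So on the line's carriers the OPEN content of the bet is exactly the NON-effective pro-classes
(Bloch–Esnault–Kerz §1 Remark (iii): "one might have to move `ξ̂` to another pro-class with the same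
Chern character"), and of route `PadicSemiregularLift`'s engine at this junction only P1a remains.

What is NOT claimed: P itself; P1a, Hu's claims or Deligne's degeneration (hypotheses where they
occur); Grothendieck existence for non-projective proper models (item 14106 in general); anything
about `VariationalHodge` or the Hodge conjecture.

References: [BlochEsnaultKerz2014pAdic] §1 ((1.3), Conj. 1.2, Thm. 1.3, Remark (iii));
[AntieauMathewMorrowNikolaus2022] Conj. 1.3, Question 1.4; [GortzWedhorn2023] Thm. 24.94, Prop. 24.95,
Lemma 24.103; [EGAIII1] Thm. 5.1.4, Cor. 5.2.4; [Hu2025TruncatedWitt] Thm. 1.2; [Deligne1968] Thm. 5.5 (ii).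
-/

noncomputable section

-- every declaration of this problem lives in `Summit.HodgeConjecture.HodgeConjecture.…` (summit = sub-problem)
set_option linter.dupNamespace false

open CategoryTheory CategoryTheory.Limits AlgebraicGeometry
open scoped TensorProduct Isocrystal
open Literature.AlgebraicGeometry Literature.AlgebraicGeometry.Motives
open Literature.AlgebraicGeometry.KTheory Literature.AlgebraicGeometry.Crystalline
open Summit.HodgeConjecture.HodgeConjecture.Theses.PadicSemiregularLift
  (FormalLiftingFromClassLifting HuInfinitesimalKZero HodgeDeRhamDegeneration)

namespace Summit.HodgeConjecture.HodgeConjecture.Theorems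

variable {p : ℕ} [Fact p.Prime] {κ : Type} [Field κ] [CharP κ p] [PerfectRing κ p]
  (𝒴 : SchemeOver (WittVector p κ))

/-! ## §1 The rung without hypothesis: effective pro-classes on projective `W(κ)`-schemes algebraize -/

section Rung

/-- **The class of a formally lifting bundle algebraizes on a projective `W(κ)`-scheme** (`κ` perfect):
if `E₁` on `Y_κ` lifts to a compatible tower of vector bundles on the thickenings of a `W(κ)`-scheme `𝒴`
projective over `W(κ)`, then `[E₁]_ℚ ∈ im(K₀(𝒴)_ℚ → K₀(Y_κ)_ℚ)` — Bloch–Esnault–Kerz §1 (1.3) for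
vector bundles, through the PROVED projective case of Grothendieck's existence theorem
(`Motives.liftsTo_of_liftsFormally_of_isProjectiveOverRing`). [cite: BlochEsnaultKerz2014pAdic, §1 (1.3)]
[cite: GortzWedhorn2023, Prop 24.95 and Lemma 24.103] [cite: EGAIII1, Thm 5.1.4 and Cor 5.2.4] -/
theorem of_mem_range_map_specialFibreι_of_liftsFormally_of_isProjectiveOverRing
    (hproj : IsProjectiveOverRing 𝒴)
    {E₁ : (WittScheme.specialFibre 𝒴).left.Modules} (hE₁ : IsFiniteLocallyFree E₁)
    (h : WittScheme.LiftsFormally 𝒴 E₁) :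
    KZeroRat.of E₁ hE₁ ∈ LinearMap.range (KZeroRat.map (WittScheme.specialFibreι 𝒴)) :=
  of_mem_range_map_specialFibreι_of_liftsTo 𝒴 hE₁ (liftsTo_of_liftsFormally_of_isProjectiveOverRing hproj h)

/-- **THE RUNG, UNCONDITIONAL — STUB P holds on effective pro-classes over projective `W(κ)`-schemes.**
On a `W(κ)`-scheme `𝒴` projective over `W(κ)`, `κ` perfect of characteristic `p`: if the bottom class
`ξ̂|_{X_0}` of a rational pro-class `ξ̂ ∈ (lim_n K₀(𝒴 ⊗ W/p^{n+1})) ⊗ ℚ` is the class of the bottom bundle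
`E_0` of a compatible tower `(E_n)_n` of vector bundles on the thickenings, then `ProClassAlgebraizes 𝒴 ξ̂`
(verbatim): `ξ̂|_{Y_κ}` is the restriction of an algebraic class `η ∈ K₀(𝒴)_ℚ` — `η = [F]` for the
algebraization `F` of the tower (EGA III₁ 5.1.4 + 5.2.4, projective case, proved in the tree). No named
fact, no route item is assumed. [cite: BlochEsnaultKerz2014pAdic, §1 (1.3), Conj. 1.2, Remark (iii)]
[cite: AntieauMathewMorrowNikolaus2022, Conj. 1.3] [cite: GortzWedhorn2023, Prop 24.95 and Lemma 24.103] -/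
theorem proClassAlgebraizes_of_tower_of_isProjectiveOverRing (hproj : IsProjectiveOverRing 𝒴)
    (E : ∀ n : ℕ, (KTheory.thickening (Ideal.span {(p : WittVector p κ)}) 𝒴 n).Modules)
    (hE : ∀ n, IsFiniteLocallyFree (E n))
    (hc : ∀ n, Nonempty ((Scheme.Modules.pullback
      (thickeningTransition (Ideal.span {(p : WittVector p κ)}) 𝒴 n)).obj (E (n + 1)) ≅ E n))
    (ξ : ContinuousKZeroRat (Ideal.span {(p : WittVector p κ)}) 𝒴)
    (hξ : ContinuousKZeroRat.specialFibre (Ideal.span {(p : WittVector p κ)}) 𝒴 ξ =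
      KZeroRat.of (E 0) (hE 0)) :
    ∃ η : KZeroRat 𝒴.left,
        KZeroRat.map (WittScheme.specialFibreι 𝒴) η =
          KZeroRat.map (specialFibreToTower 𝒴)
            (ContinuousKZeroRat.specialFibre (Ideal.span {(p : WittVector p κ)}) 𝒴 ξ) := by
  rw [proClassAlgebraizes_iff_specialFibre_mem_range, hξ, KZeroRat.map_of]
  exact of_mem_range_map_specialFibreι_of_liftsFormally_of_isProjectiveOverRing 𝒴 hproj _
    (liftsFormally_of_tower 𝒴 E hE hc)

/-- **`ℚ`-span form of the unconditional rung.** On a `W(κ)`-scheme projective over `W(κ)`, `κ` perfect: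
STUB P holds for every rational pro-class `ξ̂` whose bottom class `ξ̂|_{X_0}` lies in the `ℚ`-span of the
bottom classes `[E_0]_ℚ` of compatible towers of vector bundles (so for all formal differences of
effective towers). [cite: BlochEsnaultKerz2014pAdic, §1 (1.3) and Remark (iii)]
[cite: GortzWedhorn2023, Prop 24.95 and Lemma 24.103] -/
theorem proClassAlgebraizes_of_mem_span_effective_of_isProjectiveOverRing
    (hproj : IsProjectiveOverRing 𝒴)
    (ξ : ContinuousKZeroRat (Ideal.span {(p : WittVector p κ)}) 𝒴)
    (hξ : ContinuousKZeroRat.specialFibre (Ideal.span {(p : WittVector p κ)}) 𝒴 ξ ∈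
      Submodule.span ℚ
        {c : KZeroRat (KTheory.thickening (Ideal.span {(p : WittVector p κ)}) 𝒴 0) |
          ∃ (E : ∀ n : ℕ, (KTheory.thickening (Ideal.span {(p : WittVector p κ)}) 𝒴 n).Modules)
            (hE : ∀ n, IsFiniteLocallyFree (E n)),
            (∀ n, Nonempty ((Scheme.Modules.pullback
              (thickeningTransition (Ideal.span {(p : WittVector p κ)}) 𝒴 n)).obj (E (n + 1)) ≅
                E n)) ∧
            c = KZeroRat.of (E 0) (hE 0)}) :
    ∃ η : KZeroRat 𝒴.left,
        KZeroRat.map (WittScheme.specialFibreι 𝒴) η =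
          KZeroRat.map (specialFibreToTower 𝒴)
            (ContinuousKZeroRat.specialFibre (Ideal.span {(p : WittVector p κ)}) 𝒴 ξ) := by
  rw [proClassAlgebraizes_iff_specialFibre_mem_range]
  have hle : Submodule.span ℚ
      {c : KZeroRat (KTheory.thickening (Ideal.span {(p : WittVector p κ)}) 𝒴 0) |
        ∃ (E : ∀ n : ℕ, (KTheory.thickening (Ideal.span {(p : WittVector p κ)}) 𝒴 n).Modules)
          (hE : ∀ n, IsFiniteLocallyFree (E n)),
          (∀ n, Nonempty ((Scheme.Modules.pullback
            (thickeningTransition (Ideal.span {(p : WittVector p κ)}) 𝒴 n)).obj (E (n + 1)) ≅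
              E n)) ∧
          c = KZeroRat.of (E 0) (hE 0)} ≤
      Submodule.comap (KZeroRat.map (specialFibreToTower 𝒴))
        (LinearMap.range (KZeroRat.map (WittScheme.specialFibreι 𝒴))) := by
    refine Submodule.span_le.mpr ?_
    rintro c ⟨E, hE, hc, rfl⟩
    rw [SetLike.mem_coe, Submodule.mem_comap, KZeroRat.map_of]
    exact of_mem_range_map_specialFibreι_of_liftsFormally_of_isProjectiveOverRing 𝒴 hproj _
      (liftsFormally_of_tower 𝒴 E hE hc)
  exact hle hξ

/-- **STUB P with TWO extra binders — projectivity of the model over `W(κ)` and effectivity of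
`ξ̂|_{X_0}` — holds with NO hypothesis** (the bet's quantifier block verbatim: `∀ d ∃ p₀ ∀ p ≥ p₀ ∀ κ …
∀ 𝒴 smooth proper model ∀ ξ̂`, with `p₀ = 0`; of `IsSmoothProperModel` nothing is used). Compare gen 39's
`padicImageAlgebraization_effective_of_grothendieckExistence` (one binder, modulo the named fact for all
proper models): on the line's carriers — the models of `padicModelSupply_projective` /
`padicDiscData_of_isQuasiProjectiveOver` are projective over `W(κ)` — the extra binder is free.
[cite: BlochEsnaultKerz2014pAdic, §1 (1.3) and Conj. 1.2] [cite: AntieauMathewMorrowNikolaus2022, Conj. 1.3]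
[cite: GortzWedhorn2023, Prop 24.95 and Lemma 24.103] -/
theorem padicImageAlgebraization_effective_projective :
    ∀ d : ℕ, ∃ p₀ : ℕ, ∀ (p : ℕ) [Fact p.Prime], p₀ ≤ p →
    ∀ (κ : Type) [Field κ] [CharP κ p] [PerfectRing κ p] [IsAlgClosed κ] [Algebra (ZMod p) κ],
    Algebra.IsAlgebraic (ZMod p) κ →
    ∀ (𝒴 : SchemeOver (WittVector p κ)), WittScheme.IsSmoothProperModel d 𝒴 →
    -- extra binder: the model is projective over `W(κ)`
    IsProjectiveOverRing 𝒴 →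
    ∀ ξ : ContinuousKZeroRat (Ideal.span {(p : WittVector p κ)}) 𝒴,
    -- extra binder: the bottom class is effective
    (∃ (E : ∀ n : ℕ, (KTheory.thickening (Ideal.span {(p : WittVector p κ)}) 𝒴 n).Modules)
        (hE : ∀ n, IsFiniteLocallyFree (E n)),
        (∀ n, Nonempty ((Scheme.Modules.pullback
          (thickeningTransition (Ideal.span {(p : WittVector p κ)}) 𝒴 n)).obj (E (n + 1)) ≅ E n)) ∧
        ContinuousKZeroRat.specialFibre (Ideal.span {(p : WittVector p κ)}) 𝒴 ξ =
          KZeroRat.of (E 0) (hE 0)) →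
    ∃ η : KZeroRat 𝒴.left,
      KZeroRat.map (WittScheme.specialFibreι 𝒴) η =
        KZeroRat.map (specialFibreToTower 𝒴)
          (ContinuousKZeroRat.specialFibre (Ideal.span {(p : WittVector p κ)}) 𝒴 ξ) := by
  intro d
  refine ⟨0, ?_⟩
  intro p _ _ κ _ _ _ _ _ _ 𝒴 _ hproj ξ hξ
  obtain ⟨E, hE, hc, hξ⟩ := hξ
  exact proClassAlgebraizes_of_tower_of_isProjectiveOverRing 𝒴 hproj E hE hc ξ hξ

end Rung

/-! ## §2 On the line's own models -/

section LineModels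

/-- **On the models of the line's MODEL SUPPLY every effective pro-class algebraizes.** For every
complex smooth projective variety `X` of dimension `n` and every bound `N`, the `W(𝔽̄_q)`-model `𝒴`
(`q ≥ N`, `n + 6 < q`) of `X` supplied by `padicModelSupply_projective_of_isSmoothProjective` (gen 33:
Cassels' embedding + smooth projective spreading-out) is projective over `W`, so STUB P's conclusion holds
on it for every pro-class with effective bottom class — the instance of the bet the line needs is thus
bounded exactly by the non-effective pro-classes on THESE models.
[cite: BlochEsnaultKerz2014pAdic, §1 (1.3) and Remark (iii)] [cite: MaulikPoonen2012, §4] -/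
theorem proClassAlgebraizes_of_tower_of_padicModelSupply {n : ℕ} {X : SchemeOver ℂ}
    (hX : IsSmoothProjective n X) (N : ℕ) :
    ∃ (q : ℕ) (_ : Fact q.Prime) (κ : Type) (_ : Field κ) (_ : CharP κ q) (_ : PerfectRing κ q)
      (_ : IsAlgClosed κ) (_ : Algebra (ZMod q) κ) (_ : Algebra.IsAlgebraic (ZMod q) κ)
      (𝒴 : SchemeOver (WittVector q κ)) (ι : K(q, κ) →+* ℂ),
      N ≤ q ∧ n + 6 < q ∧ WittScheme.IsSmoothProperModel n 𝒴 ∧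
      Nonempty ((baseChangeHom ι).obj (WittScheme.genericFibre 𝒴) ≅ X) ∧
      ∀ (E : ∀ m : ℕ, (KTheory.thickening (Ideal.span {(q : WittVector q κ)}) 𝒴 m).Modules)
        (hE : ∀ m, IsFiniteLocallyFree (E m)),
        (∀ m, Nonempty ((Scheme.Modules.pullback
          (thickeningTransition (Ideal.span {(q : WittVector q κ)}) 𝒴 m)).obj (E (m + 1)) ≅ E m)) →
        ∀ ξ : ContinuousKZeroRat (Ideal.span {(q : WittVector q κ)}) 𝒴,
          ContinuousKZeroRat.specialFibre (Ideal.span {(q : WittVector q κ)}) 𝒴 ξ =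
            KZeroRat.of (E 0) (hE 0) →
          ∃ η : KZeroRat 𝒴.left,
            KZeroRat.map (WittScheme.specialFibreι 𝒴) η =
              KZeroRat.map (specialFibreToTower 𝒴)
                (ContinuousKZeroRat.specialFibre (Ideal.span {(q : WittVector q κ)}) 𝒴 ξ) := by
  obtain ⟨q, hq, κ, hκF, hκC, hκP, hκA, hκAlg, hκalg, 𝒴, ι, hNq, hnq, h𝒴, hproj, hiso⟩ :=
    padicModelSupply_projective_of_isSmoothProjective hX N
  exact ⟨q, hq, κ, hκF, hκC, hκP, hκA, hκAlg, hκalg, 𝒴, ι, hNq, hnq, h𝒴, hiso,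
    fun E hE hc ξ hξ => proClassAlgebraizes_of_tower_of_isProjectiveOverRing 𝒴 hproj E hE hc ξ hξ⟩

end LineModels

/-! ## §3 The junction with route `PadicSemiregularLift` WITHOUT P3a -/

section Junction

/-- **P1a ALONE proves STUB P for pro-classes with a (⋆)-bottom bundle on P1a-models.** On a smooth
proper `W(κ)`-model `𝒴`, projective over `W`, of relative dimension `d`, `d + 6 < p`, with the
torsion-freeness hypotheses of P1a (`FormalLiftingFromClassLifting`, stmt-HodgeConjecture-13825): if the
bottom class `ξ̂|_{Y_κ}` of a rational pro-class `ξ̂` is the class of a finite locally free `E₁` satisfying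
(⋆) CLASS-LIFTS-IMPLY-OBJECT-LIFTS, then P1a (fed with `ξ̂` itself) makes `E₁` lift formally, the PROVED
projective Grothendieck existence theorem algebraizes the lift, and `η = [F]_ℚ` has `η|_{Y_κ} = ξ̂|_{Y_κ}`.
Gen 39's `proClassAlgebraizes_of_padicSemiregularLiftEngine` minus its hypothesis P3a
(`FormalVectorBundlesAlgebraize`, stmt-HodgeConjecture-14106), which P1a's projectivity makes redundant.
[cite: BlochEsnaultKerz2014pAdic, Thm. 1.3 and §1 (1.3)] [cite: GortzWedhorn2023, Prop 24.95 and Lemma 24.103] -/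
theorem proClassAlgebraizes_of_formalLiftingFromClassLifting
    (hP1a : FormalLiftingFromClassLifting) {d : ℕ}
    (h𝒴 : WittScheme.IsSmoothProperModel d 𝒴) (hproj : IsProjectiveOverRing 𝒴) (hp : d + 6 < p)
    (hO : ∀ (b : ℕ) (x : structureSheafCohomology 𝒴.left b), (p : ℤ) • x = 0 → x = 0)
    (hΩ : ∀ (b : ℕ) (x : hodgeCohomologyOne 𝒴 b), (p : ℤ) • x = 0 → x = 0)
    (hd : d ≤ 3 ∨
      Nonempty (cotangentSheaf 𝒴 ≅ SheafOfModules.free (R := 𝒴.left.ringCatSheaf) (Fin d)))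
    {E₁ : (WittScheme.specialFibre 𝒴).left.Modules} (hE₁ : IsFiniteLocallyFree E₁)
    (hstar : ∀ (n : ℕ) (F : (WittScheme.thickening 𝒴 (n + 1)).left.Modules)
      (hF : IsFiniteLocallyFree F),
      Nonempty ((Scheme.Modules.pullback (WittScheme.specialFibreToThickening 𝒴 n)).obj F ≅ E₁) →
      (∃ y : KZero (WittScheme.thickening 𝒴 (n + 2)).left,
        KZero.map (WittScheme.thickeningMap 𝒴 (Nat.le_succ (n + 1))) y = KZero.of F hF) →
      ∃ F' : (WittScheme.thickening 𝒴 (n + 2)).left.Modules, IsFiniteLocallyFree F' ∧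
        Nonempty ((Scheme.Modules.pullback
          (WittScheme.thickeningMap 𝒴 (Nat.le_succ (n + 1)))).obj F' ≅ F))
    (ξ : ContinuousKZeroRat (Ideal.span {(p : WittVector p κ)}) 𝒴)
    (hξ : KZeroRat.map (specialFibreToTower 𝒴)
      (ContinuousKZeroRat.specialFibre (Ideal.span {(p : WittVector p κ)}) 𝒴 ξ) = KZeroRat.of E₁ hE₁) :
    ∃ η : KZeroRat 𝒴.left,
        KZeroRat.map (WittScheme.specialFibreι 𝒴) η =
          KZeroRat.map (specialFibreToTower 𝒴)
            (ContinuousKZeroRat.specialFibre (Ideal.span {(p : WittVector p κ)}) 𝒴 ξ) :=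
  proClassAlgebraizes_of_liftsTo_of_specialFibre_eq 𝒴 hE₁
    (liftsTo_of_liftsFormally_of_isProjectiveOverRing hproj
      (hP1a p κ d 𝒴 h𝒴 hproj hp hO hΩ hd E₁ hE₁ hstar ⟨ξ, hξ⟩)) ξ hξ

/-- **The same from the ANTECEDENTS of P1a in the route** — Hu's two `K₀`-claims (`HuInfinitesimalKZero`)
and Deligne's degeneration of Hodge–de Rham modulo torsion (`HodgeDeRhamDegeneration`) give P1a by the
CLOSED glue `formalLiftingFromClassLiftingOfHu_proof` (stmt-HodgeConjecture-15976) —, again without P3a.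
[cite: Hu2025TruncatedWitt, Thm. 1.2 and Cor. 10.5 (i)] [cite: Deligne1968, Thm. 5.5 (ii)]
[cite: BlochEsnaultKerz2014pAdic, Thm. 1.3] -/
theorem proClassAlgebraizes_of_hu_of_hodgeDeRhamDegeneration_of_isProjectiveOverRing
    (hHu : HuInfinitesimalKZero) (hdeg : HodgeDeRhamDegeneration)
    {d : ℕ} (h𝒴 : WittScheme.IsSmoothProperModel d 𝒴) (hproj : IsProjectiveOverRing 𝒴) (hp : d + 6 < p)
    (hO : ∀ (b : ℕ) (x : structureSheafCohomology 𝒴.left b), (p : ℤ) • x = 0 → x = 0)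
    (hΩ : ∀ (b : ℕ) (x : hodgeCohomologyOne 𝒴 b), (p : ℤ) • x = 0 → x = 0)
    (hd : d ≤ 3 ∨
      Nonempty (cotangentSheaf 𝒴 ≅ SheafOfModules.free (R := 𝒴.left.ringCatSheaf) (Fin d)))
    {E₁ : (WittScheme.specialFibre 𝒴).left.Modules} (hE₁ : IsFiniteLocallyFree E₁)
    (hstar : ∀ (n : ℕ) (F : (WittScheme.thickening 𝒴 (n + 1)).left.Modules)
      (hF : IsFiniteLocallyFree F),
      Nonempty ((Scheme.Modules.pullback (WittScheme.specialFibreToThickening 𝒴 n)).obj F ≅ E₁) →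
      (∃ y : KZero (WittScheme.thickening 𝒴 (n + 2)).left,
        KZero.map (WittScheme.thickeningMap 𝒴 (Nat.le_succ (n + 1))) y = KZero.of F hF) →
      ∃ F' : (WittScheme.thickening 𝒴 (n + 2)).left.Modules, IsFiniteLocallyFree F' ∧
        Nonempty ((Scheme.Modules.pullback
          (WittScheme.thickeningMap 𝒴 (Nat.le_succ (n + 1)))).obj F' ≅ F))
    (ξ : ContinuousKZeroRat (Ideal.span {(p : WittVector p κ)}) 𝒴)
    (hξ : KZeroRat.map (specialFibreToTower 𝒴)
      (ContinuousKZeroRat.specialFibre (Ideal.span {(p : WittVector p κ)}) 𝒴 ξ) = KZeroRat.of E₁ hE₁) :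
    ∃ η : KZeroRat 𝒴.left,
        KZeroRat.map (WittScheme.specialFibreι 𝒴) η =
          KZeroRat.map (specialFibreToTower 𝒴)
            (ContinuousKZeroRat.specialFibre (Ideal.span {(p : WittVector p κ)}) 𝒴 ξ) :=
  proClassAlgebraizes_of_formalLiftingFromClassLifting 𝒴 (formalLiftingFromClassLiftingOfHu_proof hHu hdeg)
    h𝒴 hproj hp hO hΩ hd hE₁ hstar ξ hξ

/-- **STUB P (quantifier block verbatim, `p₀ = d + 7`) on P1a-models, for pro-classes with a
(⋆)-bottom bundle, from route `PadicSemiregularLift`'s item P1a ALONE** — gen 39's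
`padicImageAlgebraization_star_of_padicSemiregularLiftEngine` with the hypothesis P3a
(`FormalVectorBundlesAlgebraize`) discharged by the proved projective Grothendieck existence theorem.
[cite: BlochEsnaultKerz2014pAdic, Conj. 1.2 and Thm. 1.3] [cite: AntieauMathewMorrowNikolaus2022, Conj. 1.3]
[cite: GortzWedhorn2023, Prop 24.95 and Lemma 24.103] -/
theorem padicImageAlgebraization_star_of_formalLiftingFromClassLifting
    (hP1a : FormalLiftingFromClassLifting) :
    ∀ d : ℕ, ∃ p₀ : ℕ, ∀ (p : ℕ) [Fact p.Prime], p₀ ≤ p →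
    ∀ (κ : Type) [Field κ] [CharP κ p] [PerfectRing κ p] [IsAlgClosed κ] [Algebra (ZMod p) κ],
    Algebra.IsAlgebraic (ZMod p) κ →
    ∀ (𝒴 : SchemeOver (WittVector p κ)), WittScheme.IsSmoothProperModel d 𝒴 →
    -- extra binders: P1a's model hypotheses
    IsProjectiveOverRing 𝒴 →
    (∀ (b : ℕ) (x : structureSheafCohomology 𝒴.left b), (p : ℤ) • x = 0 → x = 0) →
    (∀ (b : ℕ) (x : hodgeCohomologyOne 𝒴 b), (p : ℤ) • x = 0 → x = 0) →
    (d ≤ 3 ∨ Nonempty (cotangentSheaf 𝒴 ≅ SheafOfModules.free (R := 𝒴.left.ringCatSheaf) (Fin d))) →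
    ∀ ξ : ContinuousKZeroRat (Ideal.span {(p : WittVector p κ)}) 𝒴,
    -- extra binder: a (⋆)-bottom bundle
    (∃ (E₁ : (WittScheme.specialFibre 𝒴).left.Modules) (hE₁ : IsFiniteLocallyFree E₁),
      (∀ (n : ℕ) (F : (WittScheme.thickening 𝒴 (n + 1)).left.Modules) (hF : IsFiniteLocallyFree F),
        Nonempty ((Scheme.Modules.pullback (WittScheme.specialFibreToThickening 𝒴 n)).obj F ≅ E₁) →
        (∃ y : KZero (WittScheme.thickening 𝒴 (n + 2)).left,
          KZero.map (WittScheme.thickeningMap 𝒴 (Nat.le_succ (n + 1))) y = KZero.of F hF) →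
        ∃ F' : (WittScheme.thickening 𝒴 (n + 2)).left.Modules, IsFiniteLocallyFree F' ∧
          Nonempty ((Scheme.Modules.pullback
            (WittScheme.thickeningMap 𝒴 (Nat.le_succ (n + 1)))).obj F' ≅ F)) ∧
      KZeroRat.map (specialFibreToTower 𝒴)
        (ContinuousKZeroRat.specialFibre (Ideal.span {(p : WittVector p κ)}) 𝒴 ξ) = KZeroRat.of E₁ hE₁) →
    ∃ η : KZeroRat 𝒴.left,
      KZeroRat.map (WittScheme.specialFibreι 𝒴) η =
        KZeroRat.map (specialFibreToTower 𝒴)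
          (ContinuousKZeroRat.specialFibre (Ideal.span {(p : WittVector p κ)}) 𝒴 ξ) := by
  intro d
  refine ⟨d + 7, ?_⟩
  intro p _ hp κ _ _ _ _ _ _ 𝒴 h𝒴 hproj hO hΩ hd ξ hξ
  obtain ⟨E₁, hE₁, hstar, hξ⟩ := hξ
  exact proClassAlgebraizes_of_formalLiftingFromClassLifting 𝒴 hP1a h𝒴 hproj (by omega) hO hΩ hd hE₁
    hstar ξ hξ

end Junction

end Summit.HodgeConjecture.HodgeConjecture.Theorems

end
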